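import Literature.Geometry.Lorentzian.NearKerrLeaf
import HarnessLib

/-!
# Abstract normal form of leaf-capture hypotheses (line `Sketch` of crux `Capture`,
# stmt-FinalStateConjecture-10115; skeleton v7 §9, lead c3, cycle 4)

The two soft steps of line `Sketch` — HOLE-COUNT STABILISATION (`stub_holeCount`, p102731) and
LABEL PINNING (`stub_pinning`, p103327) — were landed for the typed leaf predicate
`CauchyDevelopment.IsNearKerrLeaf`.  Their proofs use nothing about leaves except monotonicity in
`(k, ε)`.  This file lands the ABSTRACT versions, for an arbitrary family of leaf predicates
`P N k ε M a S` on a vacuum Cauchy development, monotone in `(k, ε)`: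

* `holeCount_abstract` — if for every `(k, ε > 0, K compact)` there is a `P`-leaf beyond `J⁻(K)`
  with `N ≤ N₀` holes, masses in `[m₀, m₀⁻¹]` and the margin `|aᵢ| ≤ χ Mᵢ` once `k₁ ≤ k`, `ε ≤ ε₁`,
  then ONE hole count `N ≤ N₀` serves every `(k, ε, K)` with the margin at every `(k, ε)`
  (pigeonhole over `N ≤ N₀` + the common refinement of the witnesses);
* `pinning_abstract` — for a fixed hole count, ONE label `(M⋆, a⋆)` of the compact window is
  approached to every accuracy by `P`-leaves at every `(k, ε, K)` (finite subcover + refinement);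
* `exists_window_of_subextremal` — conversely, positive sub-extremal labels `(M⋆, a⋆)` on `N ≥ 1`
  holes carry an explicit accuracy `η > 0`, window `m₀ > 0` and margin `χ < 1` such that all labels
  `η`-close to `(M⋆, a⋆)` lie in `[m₀, m₀⁻¹]` with `|aᵢ| ≤ χ Mᵢ` (the label arithmetic of
  `pinnedCapture_of_capture`, p113723).

So ANY re-typing of the leaf predicate that stays monotone in `(k, ε)` (in particular the honest
leaves `IsHonestNearKerrLeaf` of the skeleton's §7) inherits the normal form
"crux ↔ ∀ N, pinned capture at hole count N" by three one-line applications (skeleton §9,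
`honestCapture_iff_forall`).  Registered sub-goals `holeCount_abstract`, `pinning_abstract`,
`exists_window_of_subextremal` of stmt-FinalStateConjecture-10115.

References: Dafermos–Holzegel–Rodnianski–Taylor arXiv:2104.08222, §1 (leaf vocabulary); O'Neill
1983, Ch. 14, p. 403 (monotonicity of causal pasts).  No named facts; no definitions.
-/

-- the doubled `FinalStateConjecture.FinalStateConjecture` path component trips dupNamespace
set_option linter.dupNamespace false

noncomputable section

namespace Summit.FinalStateConjecture.FinalStateConjecture.Theorems.BartnikGapSettling.Capture.NormalForm

open Set Filter Topology
open scoped Manifold ContDiff ENNReal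
open Literature.Geometry.Lorentzian

/-- `J⁻` is monotone in the set (O'Neill 1983, Ch. 14, p. 403). [folklore] -/
private theorem causalPast_mono (𝓢 : Spacetime 4) {S T : Set 𝓢.carrier} (h : S ⊆ T) :
    𝓢.metric.causalPast 𝓢.timeOrientation S ⊆ 𝓢.metric.causalPast 𝓢.timeOrientation T := by
  unfold LorentzianMetric.causalPast
  exact LorentzianMetric.causalFuture_mono h

/-- The label window `{(M, a) | ∀ i, m₀ ≤ Mᵢ ≤ m₀⁻¹ ∧ |aᵢ| ≤ χ Mᵢ}` is compact (closed, inside the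
box `[m₀, m₀⁻¹]^N × [-B, B]^N`, `B = |χ| max |m₀| |m₀⁻¹|`). [folklore] -/
private theorem isCompact_window (N : ℕ) (m₀ χ : ℝ) :
    IsCompact {p : (Fin N → ℝ) × (Fin N → ℝ) |
      ∀ i, m₀ ≤ p.1 i ∧ p.1 i ≤ m₀⁻¹ ∧ |p.2 i| ≤ χ * p.1 i} := by
  have h1 : ∀ i : Fin N, Continuous fun p : (Fin N → ℝ) × (Fin N → ℝ) => p.1 i := fun i =>
    (continuous_apply i).comp continuous_fst
  have h2 : ∀ i : Fin N, Continuous fun p : (Fin N → ℝ) × (Fin N → ℝ) => p.2 i := fun i =>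
    (continuous_apply i).comp continuous_snd
  have hclosed : IsClosed {p : (Fin N → ℝ) × (Fin N → ℝ) |
      ∀ i, m₀ ≤ p.1 i ∧ p.1 i ≤ m₀⁻¹ ∧ |p.2 i| ≤ χ * p.1 i} := by
    simp only [setOf_forall, setOf_and]
    exact isClosed_iInter fun i => (isClosed_le continuous_const (h1 i)).inter
      ((isClosed_le (h1 i) continuous_const).inter
        (isClosed_le (h2 i).abs (continuous_const.mul (h1 i))))
  have hbox : IsCompact ((univ.pi fun _ : Fin N => Icc m₀ m₀⁻¹) ×ˢ
      (univ.pi fun _ : Fin N => Icc (-(|χ| * max |m₀| |m₀⁻¹|)) (|χ| * max |m₀| |m₀⁻¹|))) :=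
    (isCompact_univ_pi fun _ => isCompact_Icc).prod (isCompact_univ_pi fun _ => isCompact_Icc)
  refine hbox.of_isClosed_subset hclosed fun p hp => ?_
  have hp : ∀ i, m₀ ≤ p.1 i ∧ p.1 i ≤ m₀⁻¹ ∧ |p.2 i| ≤ χ * p.1 i := hp
  refine mem_prod.2 ⟨mem_univ_pi.2 fun i => mem_Icc.2 ⟨(hp i).1, (hp i).2.1⟩,
    mem_univ_pi.2 fun i => mem_Icc.2 (abs_le.1 ?_)⟩
  calc |p.2 i| ≤ χ * p.1 i := (hp i).2.2
    _ ≤ |χ * p.1 i| := le_abs_self _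
    _ = |χ| * |p.1 i| := abs_mul _ _
    _ ≤ |χ| * max |m₀| |m₀⁻¹| :=
      mul_le_mul_of_nonneg_left (abs_le_max_abs_abs (hp i).1 (hp i).2.1) (abs_nonneg _)

/-- **Hole-count stabilisation, abstract** (registered sub-goal `holeCount_abstract` of
stmt-FinalStateConjecture-10115): the argument of `stub_holeCount` (p102731) for ANY family of leaf
predicates `P N k ε M a S` monotone in `(k, ε)` — pigeonhole over the `N₀ + 1` hole counts applied
at the common refinement `(sup kₙ ⊔ k₁, inf εₙ ⊓ ε₁, ⋃ Kₙ)` of the failing witnesses. [folklore] -/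
theorem holeCount_abstract :
    ∀ (X : Type) [TopologicalSpace X] [ChartedSpace E3 X] [IsManifold (𝓡 3) ∞ X] [ConnectedSpace X]
      (D : InitialDataSet (𝓡 3) X) (𝒟 : VacuumCauchyDevelopment D)
      (P : ∀ N : ℕ, ℕ → ℝ≥0∞ → (Fin N → ℝ) → (Fin N → ℝ) → Set 𝒟.carrier → Prop),
      (∀ N k k' ε ε' M a S, k ≤ k' → ε ≤ ε' → P N k' ε M a S → P N k ε' M a S) →
      ∀ (N₀ : ℕ) (m₀ χ : ℝ) (k₁ : ℕ) (ε₁ : ℝ≥0∞), 0 < ε₁ →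
      (∀ (k : ℕ) (ε : ℝ≥0∞), 0 < ε → ∀ K : Set 𝒟.carrier, IsCompact K →
        ∃ (N : ℕ) (M a : Fin N → ℝ) (S : Set 𝒟.carrier), N ≤ N₀ ∧ (∀ i, m₀ ≤ M i ∧ M i ≤ m₀⁻¹) ∧
          Disjoint S (𝒟.metric.causalPast 𝒟.timeOrientation K) ∧ P N k ε M a S ∧
            (k₁ ≤ k → ε ≤ ε₁ → ∀ i, |a i| ≤ χ * M i)) →
      ∃ N : ℕ, N ≤ N₀ ∧
        ∀ (k : ℕ) (ε : ℝ≥0∞), 0 < ε → ∀ K : Set 𝒟.carrier, IsCompact K →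
          ∃ (M a : Fin N → ℝ) (S : Set 𝒟.carrier),
            (∀ i, m₀ ≤ M i ∧ M i ≤ m₀⁻¹ ∧ |a i| ≤ χ * M i) ∧
              Disjoint S (𝒟.metric.causalPast 𝒟.timeOrientation K) ∧ P N k ε M a S := by
  intro X _ _ _ _ D 𝒟 P hmono N₀ m₀ χ k₁ ε₁ hε₁ H
  by_contra hcon
  push Not at hcon
  choose k ε hε K hK hno using fun n : Fin (N₀ + 1) => hcon n (Nat.le_of_lt_succ n.isLt)
  have hε' : 0 < Finset.univ.inf ε ⊓ ε₁ :=
    lt_inf_iff.2 ⟨(Finset.lt_inf_iff ENNReal.zero_lt_top).2 fun n _ => hε n, hε₁⟩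
  obtain ⟨N, M, a, S, hN, hwin, hdisj, hleaf, hmar⟩ :=
    H (Finset.univ.sup k ⊔ k₁) (Finset.univ.inf ε ⊓ ε₁) hε' (⋃ n, K n) (isCompact_iUnion hK)
  have hmar' : ∀ i, |a i| ≤ χ * M i := hmar le_sup_right inf_le_right
  have hlt : N < N₀ + 1 := Nat.lt_succ_of_le hN
  exact hno ⟨N, hlt⟩ M a S (fun i => ⟨(hwin i).1, (hwin i).2, hmar' i⟩)
    (hdisj.mono_right (causalPast_mono 𝒟.toSpacetime (subset_iUnion K ⟨N, hlt⟩)))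
    (hmono N _ _ _ _ M a S
      ((Finset.le_sup (Finset.mem_univ (⟨N, hlt⟩ : Fin (N₀ + 1)))).trans le_sup_left)
      (inf_le_left.trans (Finset.inf_le (Finset.mem_univ (⟨N, hlt⟩ : Fin (N₀ + 1))))) hleaf)

/-- **Label pinning, abstract** (registered sub-goal `pinning_abstract` of
stmt-FinalStateConjecture-10115): the argument of `stub_pinning` (p103327) for ANY leaf predicate
`P k ε M a S` (fixed hole count) monotone in `(k, ε)` — finite subcover of the compact window by the
balls of the failing accuracies, then the common refinement of the witnesses. [folklore] -/
theorem pinning_abstract :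
    ∀ (X : Type) [TopologicalSpace X] [ChartedSpace E3 X] [IsManifold (𝓡 3) ∞ X] [ConnectedSpace X]
      (D : InitialDataSet (𝓡 3) X) (𝒟 : VacuumCauchyDevelopment D) (N : ℕ)
      (P : ℕ → ℝ≥0∞ → (Fin N → ℝ) → (Fin N → ℝ) → Set 𝒟.carrier → Prop),
      (∀ k k' ε ε' M a S, k ≤ k' → ε ≤ ε' → P k' ε M a S → P k ε' M a S) →
      ∀ (m₀ χ : ℝ),
      (∀ (k : ℕ) (ε : ℝ≥0∞), 0 < ε → ∀ K : Set 𝒟.carrier, IsCompact K →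
        ∃ (M a : Fin N → ℝ) (S : Set 𝒟.carrier),
          (∀ i, m₀ ≤ M i ∧ M i ≤ m₀⁻¹ ∧ |a i| ≤ χ * M i) ∧
            Disjoint S (𝒟.metric.causalPast 𝒟.timeOrientation K) ∧ P k ε M a S) →
      ∃ (M₀ a₀ : Fin N → ℝ), (∀ i, m₀ ≤ M₀ i ∧ M₀ i ≤ m₀⁻¹ ∧ |a₀ i| ≤ χ * M₀ i) ∧
        ∀ η : ℝ, 0 < η → ∀ (k : ℕ) (ε : ℝ≥0∞), 0 < ε → ∀ K : Set 𝒟.carrier, IsCompact K →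
          ∃ (M a : Fin N → ℝ) (S : Set 𝒟.carrier), (∀ i, |M i - M₀ i| ≤ η ∧ |a i - a₀ i| ≤ η) ∧
            Disjoint S (𝒟.metric.causalPast 𝒟.timeOrientation K) ∧ P k ε M a S := by
  intro X _ _ _ _ D 𝒟 N P hmono m₀ χ H
  by_contra hcon
  push Not at hcon
  obtain ⟨W, hW, hWc⟩ : ∃ W : Set ((Fin N → ℝ) × (Fin N → ℝ)),
      (∀ p, p ∈ W ↔ ∀ i, m₀ ≤ p.1 i ∧ p.1 i ≤ m₀⁻¹ ∧ |p.2 i| ≤ χ * p.1 i) ∧ IsCompact W :=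
    ⟨_, fun _ => Iff.rfl, isCompact_window N m₀ χ⟩
  choose η hη k ε hε K hK hno using fun c : W => hcon c.1.1 c.1.2 ((hW c.1).1 c.2)
  obtain ⟨t, ht⟩ := hWc.elim_finite_subcover (fun c : W => Metric.ball c.1 (η c))
    (fun _ => Metric.isOpen_ball) fun p hp => mem_iUnion.2 ⟨⟨p, hp⟩, Metric.mem_ball_self (hη _)⟩
  have hε' : 0 < t.inf ε := (Finset.lt_inf_iff ENNReal.zero_lt_top).2 fun c _ => hε c
  obtain ⟨M, a, S, hwin, hdisj, hleaf⟩ :=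
    H (t.sup k) (t.inf ε) hε' (⋃ c ∈ t, K c) (t.isCompact_biUnion fun c _ => hK c)
  obtain ⟨c, hc, hball⟩ := mem_iUnion₂.1 (ht ((hW (M, a)).2 hwin))
  rw [Metric.mem_ball, Prod.dist_eq, max_lt_iff] at hball
  have hM : ∀ i, |M i - c.1.1 i| ≤ η c := fun i => by
    rw [← Real.dist_eq]
    exact ((dist_le_pi_dist M c.1.1 i).trans_lt hball.1).le
  have ha : ∀ i, |a i - c.1.2 i| ≤ η c := fun i => by
    rw [← Real.dist_eq]
    exact ((dist_le_pi_dist a c.1.2 i).trans_lt hball.2).le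
  have hKc : K c ⊆ ⋃ c' ∈ t, K c' := t.subset_set_biUnion_of_mem hc
  exact hno c M a S (fun i => ⟨hM i, ha i⟩)
    (hdisj.mono_right (causalPast_mono 𝒟.toSpacetime hKc))
    (hmono _ _ _ _ M a S (Finset.le_sup hc) (Finset.inf_le hc) hleaf)

/-- **Explicit window and margin around pinned sub-extremal labels** (registered sub-goal
`exists_window_of_subextremal` of stmt-FinalStateConjecture-10115; the label arithmetic of
`pinnedCapture_of_capture`, p113723, detached from the leaf predicate): for positive sub-extremal
labels `(M⋆, a⋆)` on `N ≥ 1` holes there are `η > 0`, `m₀ > 0`, `χ < 1` such that all labels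
`η`-close to `(M⋆, a⋆)` lie in `[m₀, m₀⁻¹]` with `|aᵢ| ≤ χ Mᵢ` — gap `η := minᵢ (M⋆ᵢ − |a⋆ᵢ|)/4`,
`m₀ := minᵢ min (M⋆ᵢ − η) (M⋆ᵢ + η)⁻¹`, `χ := maxᵢ (|a⋆ᵢ| + η)/(M⋆ᵢ − η)`. [folklore] -/
theorem exists_window_of_subextremal :
    ∀ (N : ℕ), 0 < N → ∀ (M₀ a₀ : Fin N → ℝ), (∀ i, 0 < M₀ i ∧ |a₀ i| < M₀ i) →
      ∃ (η m₀ χ : ℝ), 0 < η ∧ 0 < m₀ ∧ χ < 1 ∧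
        ∀ (M a : Fin N → ℝ), (∀ i, |M i - M₀ i| ≤ η ∧ |a i - a₀ i| ≤ η) →
          ∀ i, m₀ ≤ M i ∧ M i ≤ m₀⁻¹ ∧ |a i| ≤ χ * M i := by
  intro N hN M₀ a₀ hsub
  haveI : Nonempty (Fin N) := ⟨⟨0, hN⟩⟩
  obtain ⟨i₀, hi₀⟩ := Finite.exists_min fun i ↦ M₀ i - |a₀ i|
  set η : ℝ := (M₀ i₀ - |a₀ i₀|) / 4 with hη
  have hgap : ∀ i, 4 * η ≤ M₀ i - |a₀ i| := fun i ↦ by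
    have := hi₀ i
    rw [hη]
    linarith
  have hηpos : 0 < η := by
    have := (hsub i₀).2
    rw [hη]
    linarith
  have hlo : ∀ i, 0 < M₀ i - η := fun i ↦ by
    linarith [hgap i, abs_nonneg (a₀ i), hηpos]
  have hhi : ∀ i, 0 < M₀ i + η := fun i ↦ by linarith [(hsub i).1, hηpos]
  obtain ⟨i₁, hi₁⟩ := Finite.exists_min fun i ↦ min (M₀ i - η) (M₀ i + η)⁻¹
  set m₀ : ℝ := min (M₀ i₁ - η) (M₀ i₁ + η)⁻¹ with hm₀
  have hm₀pos : 0 < m₀ := lt_min (hlo i₁) (inv_pos.2 (hhi i₁))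
  obtain ⟨i₂, hi₂⟩ := Finite.exists_max fun i ↦ (|a₀ i| + η) / (M₀ i - η)
  set χ : ℝ := (|a₀ i₂| + η) / (M₀ i₂ - η) with hχ
  have hχlt : χ < 1 := by
    rw [hχ, div_lt_one (hlo i₂)]
    linarith [hgap i₂]
  have hχnn : 0 ≤ χ := div_nonneg (by positivity) (hlo i₂).le
  refine ⟨η, m₀, χ, hηpos, hm₀pos, hχlt, fun M a hcl i ↦ ?_⟩
  have hMlo : M₀ i - η ≤ M i := by linarith [(abs_le.1 (hcl i).1).1]
  have hMhi : M i ≤ M₀ i + η := by linarith [(abs_le.1 (hcl i).1).2]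
  refine ⟨((hi₁ i).trans (min_le_left _ _)).trans hMlo, ?_, ?_⟩
  · have h1 : m₀ ≤ (M₀ i + η)⁻¹ := (hi₁ i).trans (min_le_right _ _)
    exact hMhi.trans ((le_inv_comm₀ hm₀pos (hhi i)).1 h1)
  · have hai : |a i| ≤ |a₀ i| + η := by
      have := (hcl i).2
      have h' : |a i| - |a₀ i| ≤ |a i - a₀ i| := abs_sub_abs_le_abs_sub _ _
      linarith
    have hci : (|a₀ i| + η) / (M₀ i - η) ≤ χ := hi₂ i
    calc |a i| ≤ |a₀ i| + η := hai
      _ = (|a₀ i| + η) / (M₀ i - η) * (M₀ i - η) := by rw [div_mul_cancel₀ _ (hlo i).ne']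
      _ ≤ χ * (M₀ i - η) := by gcongr; exact (hlo i).le
      _ ≤ χ * M i := by gcongr

end Summit.FinalStateConjecture.FinalStateConjecture.Theorems.BartnikGapSettling.Capture.NormalForm

end
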